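import Summits.Ventures.LatticeQCDFlow.Scoring.InfiniteVolumeDecorrelation2D
import Mathlib.MeasureTheory.Measure.HasOuterApproxClosed
import Mathlib.Probability.Independence.Integration
import HarnessLib

/-!
# The exact non-abelian area law in two dimensions, V-u: the infinite-volume state restricted to two separated blocks of links is a PRODUCT — independence, and clustering for all bounded measurable local observables

HONEST FRAMING: exact (Metropolis-corrected) sampling algorithms for lattice gauge theory;
figures of merit are autocorrelation/cost numbers at stated couplings and volumes; no
continuum-physics claim.

Venture `LatticeQCDFlow` (cell pub-lqcd), sub-topic `Scoring`; FANOUT row 5 (`s0-sun-a`), GEN-22.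
NEW WORK of the cell (placement rule).  Part V-t (`InfiniteVolumeDecorrelation2D`) proved `cov_{μ_β}(Fa, Fb) = 0` for
bounded CONTINUOUS cylinder observables with column- or row-separated support boxes, under the unique infinite-volume
state `μ_β` of two-dimensional lattice Yang–Mills (every compact second-countable `G`, continuous `ρ`, real `β`).
Here the continuity is removed by soft measure theory:

* §1 **`indepFun_restrict_of_forall_cov_eq_zero`** — on any probability measure on `G^{edges(ℤ²)}`: if every pair
  of `[−1,1]`-valued continuous cylinder observables on the finite edge sets `Sa`, `Sb` is uncorrelated, then the
  restrictions `U ↦ U|_{Sa}` and `U ↦ U|_{Sb}` are INDEPENDENT random variables (closed rectangles are approximated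
  from outside by continuous functions — `HasOuterApproxClosed` —, dominated convergence, and the π-system of closed
  rectangles generates the product Borel σ-algebra);
* §2 **`indepFun_restrict_of_col_sep`**, **`indepFun_restrict_of_row_sep`** — hence, under `μ_β`, THE LINK VARIABLES
  OF TWO BLOCKS A COLUMN (ROW) OF PLAQUETTES APART ARE INDEPENDENT: the infinite-volume two-dimensional Yang–Mills
  state restricted to `Sa ∪ Sb` is the product of its marginals;
* §3 **`integral_mul_eq_mul_integral_of_col_sep`** / **`…_row_sep`** — `∫ Fa Fb dμ_β = ∫ Fa dμ_β ∫ Fb dμ_β` for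
  all bounded MEASURABLE cylinder observables on such blocks, and **`hasExponentialDecayRate_covariance_two_measurable`**
  — for every `m > 0` and all bounded measurable local observables `F₁`, `F₂`:
  `HasExponentialDecayRate (x ↦ cov_{μ_β}(F₁, F₂ ∘ θ_x)) m`, the clustering clause of
  `Literature…osterwalder_seiler_strongCoupling` with its measurability hypotheses exactly, no gauge invariance, every
  coupling, every mass (`d = 2`).

No `def`, nothing cited as a fact, 0 sorry.
-/

noncomputable section

open MeasureTheory ProbabilityTheory Function Finset Filter Topology
open Literature.MathematicalPhysics.QuantumFieldTheory
open Literature.MathematicalPhysics.QuantumLattice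
open Summit.Ventures.LatticeQCDFlow.Theory2.Lattice
open Summit.Ventures.LatticeQCDFlow.Theory2.Lattice.TwoDim

namespace Summit.Ventures.LatticeQCDFlow.Scoring

variable {G : Type*} [Group G] [TopologicalSpace G] [IsTopologicalGroup G]
  [CompactSpace G] [T2Space G] [SecondCountableTopology G] [MeasurableSpace G] [BorelSpace G] {N : ℕ}
  (ρ : G →* Matrix (Fin N) (Fin N) ℂ)

/-! ## §1. Uncorrelated continuous cylinder observables ⇒ independent link blocks -/

section Soft

omit [CompactSpace G] in

/-- **Vanishing covariances of continuous test functions give independence of the link blocks.**  `μ` a probability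
measure on `G^{edges(ℤ²)}`, `Sa`, `Sb` finite edge sets; if `cov_μ(f, g) = 0` for all continuous cylinder observables
`f` on `Sa` and `g` on `Sb` with values in `[−1, 1]`, then `U ↦ U|_{Sa}` and `U ↦ U|_{Sb}` are independent under `μ`. -/
theorem indepFun_restrict_of_forall_cov_eq_zero (μ : Measure (LGConfig 2 G)) [IsProbabilityMeasure μ]
    (Sa Sb : Finset ((Literature.MathematicalPhysics.QuantumLattice.ZdEdge 2)))
    (h : ∀ f g : LGConfig 2 G → ℝ, IsCylinder f Sa → IsCylinder g Sb → Continuous f → Continuous g →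
      (∀ U, |f U| ≤ 1) → (∀ U, |g U| ≤ 1) → cov[f, g; μ] = 0) :
    IndepFun (fun U : LGConfig 2 G => Sa.restrict U) (fun U : LGConfig 2 G => Sb.restrict U) μ := by
  set X : LGConfig 2 G → (↥Sa → G) := fun U => Sa.restrict U with hXdef
  set Y : LGConfig 2 G → (↥Sb → G) := fun U => Sb.restrict U with hYdef
  have hXc : Continuous X := continuous_pi fun e => continuous_apply _
  have hYc : Continuous Y := continuous_pi fun e => continuous_apply _
  have hXm : Measurable X := Finset.measurable_restrict _
  have hYm : Measurable Y := Finset.measurable_restrict _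
  -- closed rectangles have product probability
  have hrect : ∀ {A : Set (↥Sa → G)} {B : Set (↥Sb → G)}, IsClosed A → IsClosed B →
      μ.real (X ⁻¹' A ∩ Y ⁻¹' B) = μ.real (X ⁻¹' A) * μ.real (Y ⁻¹' B) := by
    intro A B hA hB
    let f : ℕ → LGConfig 2 G → ℝ := fun n U => (hA.apprSeq n (X U) : ℝ)
    let g : ℕ → LGConfig 2 G → ℝ := fun n U => (hB.apprSeq n (Y U) : ℝ)
    have hfc : ∀ n, Continuous (f n) := fun n =>
      NNReal.continuous_coe.comp ((hA.apprSeq n).continuous.comp hXc)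
    have hgc : ∀ n, Continuous (g n) := fun n =>
      NNReal.continuous_coe.comp ((hB.apprSeq n).continuous.comp hYc)
    have hf0 : ∀ n U, 0 ≤ f n U := fun n U => NNReal.coe_nonneg _
    have hg0 : ∀ n U, 0 ≤ g n U := fun n U => NNReal.coe_nonneg _
    have hf1 : ∀ n U, |f n U| ≤ 1 := fun n U => by
      rw [abs_of_nonneg (hf0 n U)]
      exact_mod_cast HasOuterApproxClosed.apprSeq_apply_le_one hA n (X U)
    have hg1 : ∀ n U, |g n U| ≤ 1 := fun n U => by
      rw [abs_of_nonneg (hg0 n U)]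
      exact_mod_cast HasOuterApproxClosed.apprSeq_apply_le_one hB n (Y U)
    have hfS : ∀ n, IsCylinder (f n) Sa := fun n U V hUV => by
      have hXUV : X U = X V := funext fun e => hUV e.1 (Finset.mem_coe.2 e.2)
      show (hA.apprSeq n (X U) : ℝ) = hA.apprSeq n (X V)
      rw [hXUV]
    have hgS : ∀ n, IsCylinder (g n) Sb := fun n U V hUV => by
      have hYUV : Y U = Y V := funext fun e => hUV e.1 (Finset.mem_coe.2 e.2)
      show (hB.apprSeq n (Y U) : ℝ) = hB.apprSeq n (Y V)
      rw [hYUV]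
    -- step `n`: uncorrelated
    have hstep : ∀ n, ∫ U, f n U * g n U ∂μ = (∫ U, f n U ∂μ) * ∫ U, g n U ∂μ := fun n => by
      have hcov := h (f n) (g n) (hfS n) (hgS n) (hfc n) (hgc n) (hf1 n) (hg1 n)
      have l₁ : MemLp (f n) 2 μ := MemLp.of_bound (hfc n).measurable.aestronglyMeasurable 1
        (ae_of_all _ fun U => by simpa [Real.norm_eq_abs] using hf1 n U)
      have l₂ : MemLp (g n) 2 μ := MemLp.of_bound (hgc n).measurable.aestronglyMeasurable 1
        (ae_of_all _ fun U => by simpa [Real.norm_eq_abs] using hg1 n U)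
      rw [covariance_eq_sub l₁ l₂] at hcov
      simp only [Pi.mul_apply] at hcov
      linarith
    -- pointwise limits: indicators of the rectangles' sides
    have hlimf : ∀ U, Tendsto (fun n => f n U) atTop (𝓝 ((X ⁻¹' A).indicator (fun _ => (1 : ℝ)) U)) := by
      intro U
      have h1 := tendsto_pi_nhds.mp (HasOuterApproxClosed.tendsto_apprSeq hA) (X U)
      have h2 := (NNReal.continuous_coe.tendsto _).comp h1
      refine h2.congr' (Eventually.of_forall fun n => rfl) |>.trans ?_
      by_cases hU : X U ∈ A
      · simp [Set.indicator_of_mem hU, Set.indicator_of_mem (show U ∈ X ⁻¹' A from hU)]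
      · simp [Set.indicator_of_notMem hU, Set.indicator_of_notMem (show U ∉ X ⁻¹' A from hU)]
    have hlimg : ∀ U, Tendsto (fun n => g n U) atTop (𝓝 ((Y ⁻¹' B).indicator (fun _ => (1 : ℝ)) U)) := by
      intro U
      have h1 := tendsto_pi_nhds.mp (HasOuterApproxClosed.tendsto_apprSeq hB) (Y U)
      have h2 := (NNReal.continuous_coe.tendsto _).comp h1
      refine h2.congr' (Eventually.of_forall fun n => rfl) |>.trans ?_
      by_cases hU : Y U ∈ B
      · simp [Set.indicator_of_mem hU, Set.indicator_of_mem (show U ∈ Y ⁻¹' B from hU)]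
      · simp [Set.indicator_of_notMem hU, Set.indicator_of_notMem (show U ∉ Y ⁻¹' B from hU)]
    have hmA : MeasurableSet (X ⁻¹' A) := hXm hA.measurableSet
    have hmB : MeasurableSet (Y ⁻¹' B) := hYm hB.measurableSet
    -- dominated convergence (bound `1`)
    have hbd : ∀ (φ : LGConfig 2 G → ℝ), (∀ U, |φ U| ≤ 1) → ∀ U, ‖φ U‖ ≤ (fun _ : LGConfig 2 G => (1 : ℝ)) U :=
      fun φ hφ U => by rw [Real.norm_eq_abs]; exact hφ U
    have hTfg : Tendsto (fun n => ∫ U, f n U * g n U ∂μ) atTop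
        (𝓝 (∫ U, (X ⁻¹' A).indicator (fun _ => (1 : ℝ)) U * (Y ⁻¹' B).indicator (fun _ => (1 : ℝ)) U ∂μ)) := by
      refine tendsto_integral_of_dominated_convergence (fun _ => (1 : ℝ))
        (fun n => ((hfc n).mul (hgc n)).measurable.aestronglyMeasurable) (integrable_const 1)
        (fun n => ae_of_all _ fun U => ?_) (ae_of_all _ fun U => (hlimf U).mul (hlimg U))
      rw [Real.norm_eq_abs, abs_mul]
      nlinarith [abs_nonneg (f n U), abs_nonneg (g n U), hf1 n U, hg1 n U]
    have hTf : Tendsto (fun n => ∫ U, f n U ∂μ) atTop (𝓝 (∫ U, (X ⁻¹' A).indicator (fun _ => (1 : ℝ)) U ∂μ)) :=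
      tendsto_integral_of_dominated_convergence (fun _ => (1 : ℝ))
        (fun n => (hfc n).measurable.aestronglyMeasurable) (integrable_const 1)
        (fun n => ae_of_all _ (hbd (f n) (hf1 n))) (ae_of_all _ hlimf)
    have hTg : Tendsto (fun n => ∫ U, g n U ∂μ) atTop (𝓝 (∫ U, (Y ⁻¹' B).indicator (fun _ => (1 : ℝ)) U ∂μ)) :=
      tendsto_integral_of_dominated_convergence (fun _ => (1 : ℝ))
        (fun n => (hgc n).measurable.aestronglyMeasurable) (integrable_const 1)
        (fun n => ae_of_all _ (hbd (g n) (hg1 n))) (ae_of_all _ hlimg)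
    rw [show (fun n => ∫ U, f n U * g n U ∂μ) = fun n => (∫ U, f n U ∂μ) * ∫ U, g n U ∂μ from
      funext hstep] at hTfg
    have heq := tendsto_nhds_unique hTfg (hTf.mul hTg)
    -- the three limits are the measures
    have hprod : (fun U => (X ⁻¹' A).indicator (fun _ => (1 : ℝ)) U * (Y ⁻¹' B).indicator (fun _ => (1 : ℝ)) U) =
        (X ⁻¹' A ∩ Y ⁻¹' B).indicator (fun _ => (1 : ℝ)) := by
      funext U
      by_cases hU : U ∈ X ⁻¹' A <;> by_cases hV : U ∈ Y ⁻¹' B <;> simp [hU, hV]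
    have hI : ∀ {s : Set (LGConfig 2 G)}, MeasurableSet s →
        ∫ U, s.indicator (fun _ => (1 : ℝ)) U ∂μ = μ.real s := fun hs => by
      rw [integral_indicator hs, setIntegral_const, smul_eq_mul, mul_one]
    rw [hprod, hI (hmA.inter hmB), hI hmA, hI hmB] at heq
    exact heq
  -- independence from the closed rectangles
  rw [indepFun_iff_map_prod_eq_prod_map_map hXm.aemeasurable hYm.aemeasurable]
  haveI : IsProbabilityMeasure (μ.map X) := Measure.isProbabilityMeasure_map hXm.aemeasurable
  haveI : IsProbabilityMeasure (μ.map Y) := Measure.isProbabilityMeasure_map hYm.aemeasurable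
  haveI : IsProbabilityMeasure (μ.map fun U => (X U, Y U)) :=
    Measure.isProbabilityMeasure_map (hXm.prodMk hYm).aemeasurable
  have hCa : MeasurableSpace.generateFrom {A : Set (↥Sa → G) | IsClosed A} = (inferInstance : MeasurableSpace (↥Sa → G)) := by
    rw [← borel_eq_generateFrom_isClosed]; exact (BorelSpace.measurable_eq).symm
  have hCb : MeasurableSpace.generateFrom {B : Set (↥Sb → G) | IsClosed B} = (inferInstance : MeasurableSpace (↥Sb → G)) := by
    rw [← borel_eq_generateFrom_isClosed]; exact (BorelSpace.measurable_eq).symm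
  have hspanA : IsCountablySpanning {A : Set (↥Sa → G) | IsClosed A} :=
    ⟨fun _ => Set.univ, fun _ => isClosed_univ, Set.iUnion_const _⟩
  have hspanB : IsCountablySpanning {B : Set (↥Sb → G) | IsClosed B} :=
    ⟨fun _ => Set.univ, fun _ => isClosed_univ, Set.iUnion_const _⟩
  refine ext_of_generate_finite (Set.image2 (· ×ˢ ·) {A : Set (↥Sa → G) | IsClosed A} {B : Set (↥Sb → G) | IsClosed B})
    (generateFrom_eq_prod hCa hCb hspanA hspanB).symm (isPiSystem_isClosed.prod isPiSystem_isClosed) ?_ ?_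
  · rintro _ ⟨A, hA, B, hB, rfl⟩
    have hA' : IsClosed A := hA
    have hB' : IsClosed B := hB
    rw [Measure.map_apply (hXm.prodMk hYm) (hA'.measurableSet.prod hB'.measurableSet), Set.mk_preimage_prod,
      Measure.prod_prod, Measure.map_apply hXm hA'.measurableSet, Measure.map_apply hYm hB'.measurableSet,
      ← ofReal_measureReal, ← ofReal_measureReal (s := X ⁻¹' A), ← ofReal_measureReal (s := Y ⁻¹' B),
      hrect hA' hB', ENNReal.ofReal_mul measureReal_nonneg]
  · simp

end Soft

/-! ## §2. Independence of separated link blocks under the infinite-volume state -/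

section Blocks

/-- **LINK BLOCKS A COLUMN APART ARE INDEPENDENT under the infinite-volume two-dimensional Yang–Mills state**
(`d = 2`, every compact second-countable `G`, continuous `ρ`, every real `β`, every infinite-volume limit point `μ`):
for finite edge sets `Sa`, `Sb` whose base sites lie in boxes with columns `[a, a + Ra)` and `[a', a' + Rb)`,
`a + Ra + 1 ≤ a'`, the restrictions `U ↦ U|_{Sa}` and `U ↦ U|_{Sb}` are independent. -/
theorem indepFun_restrict_of_col_sep (hρ : Continuous ρ) {β : ℝ} {μ : Measure (LGConfig 2 G)}
    (hμ : μ ∈ infiniteVolumeLimitPoints ρ β) {Sa Sb : Finset ((Literature.MathematicalPhysics.QuantumLattice.ZdEdge 2))}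
    {a b a' b' : ℤ} {Ra Ta Rb Tb : ℕ}
    (hSa : ∀ s ∈ Sa, s.1 ∈ (range Ra ×ˢ range Ta).image
      (fun q : ℕ × ℕ => (![a + q.1, b + q.2] : (Literature.Probability.LatticeModels.Site 2))))
    (hSb : ∀ s ∈ Sb, s.1 ∈ (range Rb ×ˢ range Tb).image
      (fun q : ℕ × ℕ => (![a' + q.1, b' + q.2] : (Literature.Probability.LatticeModels.Site 2))))
    (hgap : a + Ra + 1 ≤ a') :
    IndepFun (fun U : LGConfig 2 G => Sa.restrict U) (fun U : LGConfig 2 G => Sb.restrict U) μ := by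
  obtain ⟨μ₀, hprob, -, huniq, -, -⟩ := exists_infiniteVolumeLimit_two ρ hρ β
  have hμ' := hμ
  rw [huniq, Set.mem_singleton_iff] at hμ'
  subst hμ'
  exact indepFun_restrict_of_forall_cov_eq_zero μ Sa Sb fun f g hf hg hfc hgc hf1 hg1 =>
    covariance_eq_zero_of_col_sep ρ hρ hμ hf hg hfc hgc hf1 hg1 hSa hSb hgap

/-- **LINK BLOCKS A ROW APART ARE INDEPENDENT under the infinite-volume state** (rows `[b, b + Ta)`,
`[b', b' + Tb)`, `b + Ta + 1 ≤ b'`). -/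
theorem indepFun_restrict_of_row_sep (hρ : Continuous ρ) {β : ℝ} {μ : Measure (LGConfig 2 G)}
    (hμ : μ ∈ infiniteVolumeLimitPoints ρ β) {Sa Sb : Finset ((Literature.MathematicalPhysics.QuantumLattice.ZdEdge 2))}
    {a b a' b' : ℤ} {Ra Ta Rb Tb : ℕ}
    (hSa : ∀ s ∈ Sa, s.1 ∈ (range Ra ×ˢ range Ta).image
      (fun q : ℕ × ℕ => (![a + q.1, b + q.2] : (Literature.Probability.LatticeModels.Site 2))))
    (hSb : ∀ s ∈ Sb, s.1 ∈ (range Rb ×ˢ range Tb).image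
      (fun q : ℕ × ℕ => (![a' + q.1, b' + q.2] : (Literature.Probability.LatticeModels.Site 2))))
    (hgap : b + Ta + 1 ≤ b') :
    IndepFun (fun U : LGConfig 2 G => Sa.restrict U) (fun U : LGConfig 2 G => Sb.restrict U) μ := by
  obtain ⟨μ₀, hprob, -, huniq, -, -⟩ := exists_infiniteVolumeLimit_two ρ hρ β
  have hμ' := hμ
  rw [huniq, Set.mem_singleton_iff] at hμ'
  subst hμ'
  exact indepFun_restrict_of_forall_cov_eq_zero μ Sa Sb fun f g hf hg hfc hgc hf1 hg1 =>
    covariance_eq_zero_of_row_sep ρ hρ hμ hf hg hfc hgc hf1 hg1 hSa hSb hgap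

end Blocks

/-! ## §3. Bounded measurable observables: product formula and clustering with every mass -/

section Measurable

omit [TopologicalSpace G] [IsTopologicalGroup G] [CompactSpace G] [T2Space G] [SecondCountableTopology G]
  [MeasurableSpace G] [BorelSpace G] in
/-- A measurable cylinder observable factors through the restriction to its support. -/
theorem cylinder_eq_comp_restrict {F : LGConfig 2 G → ℝ}
    {S : Finset ((Literature.MathematicalPhysics.QuantumLattice.ZdEdge 2))} (hF : IsCylinder F S) :
    F = (fun u : ↥S → G => F (padConfig S u)) ∘ fun U : LGConfig 2 G => S.restrict U := by
  funext U
  exact hF fun e he => (padConfig_restrict_apply U (Finset.mem_coe.1 he)).symm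

omit [IsTopologicalGroup G] [CompactSpace G] [T2Space G] in
/-- Independence of the link blocks gives independence of any two measurable cylinder observables on them. -/
theorem indepFun_of_cylinder {μ : Measure (LGConfig 2 G)}
    {Sa Sb : Finset ((Literature.MathematicalPhysics.QuantumLattice.ZdEdge 2))}
    (hind : IndepFun (fun U : LGConfig 2 G => Sa.restrict U) (fun U : LGConfig 2 G => Sb.restrict U) μ)
    {Fa Fb : LGConfig 2 G → ℝ} (hFa : IsCylinder Fa Sa) (hFb : IsCylinder Fb Sb) (hma : Measurable Fa)
    (hmb : Measurable Fb) : IndepFun Fa Fb μ := by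
  have ea := cylinder_eq_comp_restrict hFa
  have eb := cylinder_eq_comp_restrict hFb
  have hfa : Measurable fun u : ↥Sa → G => Fa (padConfig Sa u) := hma.comp (continuous_padConfig Sa).measurable
  have hfb : Measurable fun u : ↥Sb → G => Fb (padConfig Sb u) := hmb.comp (continuous_padConfig Sb).measurable
  have hind' : IndepFun ((fun u : ↥Sa → G => Fa (padConfig Sa u)) ∘ fun U : LGConfig 2 G => Sa.restrict U)
      ((fun u : ↥Sb → G => Fb (padConfig Sb u)) ∘ fun U : LGConfig 2 G => Sb.restrict U) μ :=
    hind.comp hfa hfb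
  rw [← ea, ← eb] at hind'
  exact hind'

omit [IsTopologicalGroup G] [CompactSpace G] [T2Space G] in
/-- **PRODUCT FORMULA FOR BOUNDED MEASURABLE OBSERVABLES**: `∫ Fa Fb dμ = ∫ Fa dμ · ∫ Fb dμ` for bounded measurable
cylinder observables on `Sa`, `Sb` whenever the two restrictions are independent (as in §2). -/
theorem integral_mul_eq_mul_integral_of_indepFun {μ : Measure (LGConfig 2 G)} [IsProbabilityMeasure μ]
    {Sa Sb : Finset ((Literature.MathematicalPhysics.QuantumLattice.ZdEdge 2))}
    (hind : IndepFun (fun U : LGConfig 2 G => Sa.restrict U) (fun U : LGConfig 2 G => Sb.restrict U) μ)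
    {Fa Fb : LGConfig 2 G → ℝ} (hFa : IsCylinder Fa Sa) (hFb : IsCylinder Fb Sb) (hma : Measurable Fa)
    (hmb : Measurable Fb) :
    ∫ U, Fa U * Fb U ∂μ = (∫ U, Fa U ∂μ) * ∫ U, Fb U ∂μ :=
  (indepFun_of_cylinder hind hFa hFb hma hmb).integral_fun_mul_eq_mul_integral hma.aestronglyMeasurable
    hmb.aestronglyMeasurable

omit [TopologicalSpace G] [IsTopologicalGroup G] [CompactSpace G] [T2Space G]
  [SecondCountableTopology G] [BorelSpace G] in
/-- Covariance of bounded measurable observables is at most `2 C₁ C₂` in absolute value. -/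
theorem abs_covariance_le_two_mul {μ : Measure (LGConfig 2 G)} [IsProbabilityMeasure μ]
    {F₁ F₂ : LGConfig 2 G → ℝ} (hm₁ : Measurable F₁) (hm₂ : Measurable F₂) {C₁ C₂ : ℝ}
    (hb₁ : ∀ U, |F₁ U| ≤ C₁) (hb₂ : ∀ U, |F₂ U| ≤ C₂) : |cov[F₁, F₂; μ]| ≤ 2 * C₁ * C₂ := by
  have hC₁ : 0 ≤ C₁ := (abs_nonneg _).trans (hb₁ fun _ => 1)
  have l₁ : MemLp F₁ 2 μ := MemLp.of_bound hm₁.aestronglyMeasurable C₁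
    (ae_of_all _ fun U => by simpa [Real.norm_eq_abs] using hb₁ U)
  have l₂ : MemLp F₂ 2 μ := MemLp.of_bound hm₂.aestronglyMeasurable C₂
    (ae_of_all _ fun U => by simpa [Real.norm_eq_abs] using hb₂ U)
  rw [covariance_eq_sub l₁ l₂]
  have e12 : |∫ U, F₁ U * F₂ U ∂μ| ≤ C₁ * C₂ := by
    refine (abs_integral_le_integral_abs).trans ?_
    calc ∫ U, |F₁ U * F₂ U| ∂μ ≤ ∫ _U, C₁ * C₂ ∂μ :=
          integral_mono_of_nonneg (ae_of_all _ fun U => abs_nonneg _) (integrable_const _)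
            (ae_of_all _ fun U => by
              show |F₁ U * F₂ U| ≤ C₁ * C₂
              rw [abs_mul]; exact mul_le_mul (hb₁ U) (hb₂ U) (abs_nonneg _) hC₁)
      _ = C₁ * C₂ := by simp
  have e1 : |∫ U, F₁ U ∂μ| ≤ C₁ := (abs_integral_le_integral_abs).trans (by
    calc ∫ U, |F₁ U| ∂μ ≤ ∫ _U, C₁ ∂μ :=
          integral_mono_of_nonneg (ae_of_all _ fun U => abs_nonneg _) (integrable_const _) (ae_of_all _ hb₁)
      _ = C₁ := by simp)
  have e2 : |∫ U, F₂ U ∂μ| ≤ C₂ := (abs_integral_le_integral_abs).trans (by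
    calc ∫ U, |F₂ U| ∂μ ≤ ∫ _U, C₂ ∂μ :=
          integral_mono_of_nonneg (ae_of_all _ fun U => abs_nonneg _) (integrable_const _) (ae_of_all _ hb₂)
      _ = C₂ := by simp)
  calc |∫ U, F₁ U * F₂ U ∂μ - (∫ U, F₁ U ∂μ) * ∫ U, F₂ U ∂μ|
      ≤ |∫ U, F₁ U * F₂ U ∂μ| + |(∫ U, F₁ U ∂μ) * ∫ U, F₂ U ∂μ| := abs_sub _ _
    _ ≤ C₁ * C₂ + C₁ * C₂ := by
      rw [abs_mul]; exact add_le_add e12 (mul_le_mul e1 e2 (abs_nonneg _) hC₁)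
    _ = 2 * C₁ * C₂ := by ring

/-- **EXPONENTIAL CLUSTERING WITH EVERY MASS FOR ALL BOUNDED MEASURABLE LOCAL OBSERVABLES** (`d = 2`, every compact
second-countable `G`, continuous `ρ`, every real `β`, every infinite-volume limit point `μ`, every `m > 0`):
`HasExponentialDecayRate (x ↦ cov_μ(F₁, F₂ ∘ θ_x)) m` — the covariance even VANISHES once `x` separates the supports. -/
theorem hasExponentialDecayRate_covariance_two_measurable (hρ : Continuous ρ) {β : ℝ}
    {μ : Measure (LGConfig 2 G)} (hμ : μ ∈ infiniteVolumeLimitPoints ρ β) {m : ℝ} (hm : 0 < m)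
    {F₁ F₂ : LGConfig 2 G → ℝ} (hF₁ : Literature.MathematicalPhysics.QuantumLattice.IsLocalObservable F₁)
    (hF₂ : Literature.MathematicalPhysics.QuantumLattice.IsLocalObservable F₂) (hm₁ : Measurable F₁)
    (hm₂ : Measurable F₂) (hb₁ : ∃ C, ∀ U, |F₁ U| ≤ C) (hb₂ : ∃ C, ∀ U, |F₂ U| ≤ C) :
    Literature.Probability.LatticeModels.HasExponentialDecayRate
      (fun x : (Literature.Probability.LatticeModels.Site 2) => cov[F₁, fun U => F₂ (configShift x U); μ]) m := by
  obtain ⟨μ₀, hprob, -, huniq, -, -⟩ := exists_infiniteVolumeLimit_two ρ hρ β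
  have hμ' := hμ
  rw [huniq, Set.mem_singleton_iff] at hμ'
  subst hμ'
  obtain ⟨S₁, hS₁⟩ := hF₁
  obtain ⟨S₂, hS₂⟩ := hF₂
  obtain ⟨C₁, hC₁⟩ := hb₁
  obtain ⟨C₂, hC₂⟩ := hb₂
  obtain ⟨a₁, b₁, R₁, T₁, hbox₁⟩ := exists_zbox_of_finset S₁
  obtain ⟨a₂, b₂, R₂, T₂, hbox₂⟩ := exists_zbox_of_finset S₂
  have hC₁0 : 0 ≤ C₁ := (abs_nonneg _).trans (hC₁ fun _ => 1)
  have hC₂0 : 0 ≤ C₂ := (abs_nonneg _).trans (hC₂ fun _ => 1)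
  set K₀ : ℝ := max ((|a₁ - a₂| + R₁ + R₂ + 1 : ℤ) : ℝ) ((|b₁ - b₂| + T₁ + T₂ + 1 : ℤ) : ℝ) with hK₀
  have hK₀0 : 0 ≤ K₀ := le_max_of_le_left (by positivity)
  refine ⟨hm, 2 * C₁ * C₂ * Real.exp (m * K₀), fun x => ?_⟩
  show |cov[F₁, fun U => F₂ (configShift x U); μ]| ≤ 2 * C₁ * C₂ * Real.exp (m * K₀) * Real.exp (-m * ‖x‖)
  have hF₂x := IsCylinder.comp_configShift hS₂ x
  have hm₂x : Measurable (F₂ ∘ configShift x) := hm₂.comp (configShift x).measurable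
  have hb₂x : ∀ U, |(F₂ ∘ configShift x) U| ≤ C₂ := fun U => hC₂ _
  have hS₂x := sites_image_shift_sub hbox₂ x
  by_cases hx : a₁ + R₁ + 1 ≤ a₂ - x 0 ∨ a₂ - x 0 + R₂ + 1 ≤ a₁ ∨ b₁ + T₁ + 1 ≤ b₂ - x 1 ∨ b₂ - x 1 + T₂ + 1 ≤ b₁
  · -- separated: the blocks are independent, the covariance vanishes
    have hzero : cov[F₁, fun U => F₂ (configShift x U); μ] = 0 := by
      have l₁ : MemLp F₁ 2 μ := MemLp.of_bound hm₁.aestronglyMeasurable C₁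
        (ae_of_all _ fun U => by simpa [Real.norm_eq_abs] using hC₁ U)
      have l₂ : MemLp (F₂ ∘ configShift x) 2 μ := MemLp.of_bound hm₂x.aestronglyMeasurable C₂
        (ae_of_all _ fun U => by simpa [Real.norm_eq_abs] using hb₂x U)
      have hind : IndepFun F₁ (F₂ ∘ configShift x) μ := by
        rcases hx with h | h | h | h
        · exact indepFun_of_cylinder (indepFun_restrict_of_col_sep ρ hρ hμ hbox₁ hS₂x h) hS₁ hF₂x hm₁ hm₂x
        · exact (indepFun_of_cylinder (indepFun_restrict_of_col_sep ρ hρ hμ hS₂x hbox₁ h) hF₂x hS₁ hm₂x hm₁).symm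
        · exact indepFun_of_cylinder (indepFun_restrict_of_row_sep ρ hρ hμ hbox₁ hS₂x h) hS₁ hF₂x hm₁ hm₂x
        · exact (indepFun_of_cylinder (indepFun_restrict_of_row_sep ρ hρ hμ hS₂x hbox₁ h) hF₂x hS₁ hm₂x hm₁).symm
      exact hind.covariance_eq_zero l₁ l₂
    rw [hzero, abs_zero]
    positivity
  · -- not separated: `‖x‖ ≤ K₀`, trivial bound
    push Not at hx
    obtain ⟨hA, hB, hC, hD⟩ := hx
    have hx0 : |x 0| ≤ |a₁ - a₂| + R₁ + R₂ + 1 := by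
      rcases abs_cases (a₁ - a₂) with ⟨h1, _⟩ | ⟨h1, _⟩ <;> rw [h1, abs_le] <;> constructor <;> omega
    have hx1 : |x 1| ≤ |b₁ - b₂| + T₁ + T₂ + 1 := by
      rcases abs_cases (b₁ - b₂) with ⟨h1, _⟩ | ⟨h1, _⟩ <;> rw [h1, abs_le] <;> constructor <;> omega
    have hnorm : ‖x‖ ≤ K₀ := by
      refine (pi_norm_le_iff_of_nonneg hK₀0).mpr fun i => ?_
      rw [Int.norm_eq_abs, ← Int.cast_abs]
      have h01 : ∀ k : Fin 2, k = 0 ∨ k = 1 := by decide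
      rcases h01 i with rfl | rfl
      · exact (Int.cast_le.mpr hx0).trans (by rw [hK₀]; exact_mod_cast le_max_left _ _)
      · exact (Int.cast_le.mpr hx1).trans (by rw [hK₀]; exact_mod_cast le_max_right _ _)
    have hexp1 : 1 ≤ Real.exp (m * K₀) * Real.exp (-m * ‖x‖) := by
      rw [← Real.exp_add]
      exact Real.one_le_exp (by nlinarith [norm_nonneg x])
    calc |cov[F₁, fun U => F₂ (configShift x U); μ]| ≤ 2 * C₁ * C₂ := abs_covariance_le_two_mul hm₁ hm₂x hC₁ hb₂x
      _ = 2 * C₁ * C₂ * 1 := by ring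
      _ ≤ 2 * C₁ * C₂ * (Real.exp (m * K₀) * Real.exp (-m * ‖x‖)) :=
        mul_le_mul_of_nonneg_left hexp1 (by positivity)
      _ = 2 * C₁ * C₂ * Real.exp (m * K₀) * Real.exp (-m * ‖x‖) := by ring

end Measurable

end Summit.Ventures.LatticeQCDFlow.Scoring
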